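import Literature.Probability.FitznerVanDerHofstad2017.SawCountKernelG
import HarnessLib

set_option Elab.async false  -- one kernel evaluation at a time (bounded memory on the farm)

/-!
# Kernel-certified SAW end-point counts `c_n(x)` on `ℤ^d`, uniformly in `d` — `c_11(x)`, `x ∼ (1,1,1,2)` (beyond the published table) — part 5/7

Continuation of `SawCountTables` by the second kernel machine `sawCodeG` of `SawCountKernelG` (same recursion,
last two levels in closed form; see there for the method, the transfer theorem `sawCount_eq_sum_sawCodeG` and
the references): the 11-step class `x ∼ (1,1,1,2)`. Part 5 of 7: self-contained kernel pieces (leaf evaluations of `sawCodeG`) only — the parts a, b, c, d, e are independent of each other; parts f, g assemble them into the theorem.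
Each coefficient is a sum of `decide +kernel` evaluations of `sawCodeG`, split along the recursion by
`sawCodeG_succ_expand`; no facts, no hypotheses beyond `s ≤ d`; no cell of the record is touched.
-/

namespace Literature.Probability.FitznerVanDerHofstad2017

open Finset Literature.Probability.LatticeModels Literature.Probability.Percolation

variable {d : ℕ}

/-! #### Kernel pieces for `card_sawWordsTo_n11_x1112` (part 5) -/

set_option maxHeartbeats 0 in
/-- Kernel piece (39254 calls). [folklore] -/
theorem card_sawWordsTo_n11_x1112_g836 : sawCodeG 10 3 4 628794940589399504710932577 4 (nextV 628794940589399504711194721 0) [628794940589399504711194721] = 37200 := by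
  decide +kernel

/-- Still-born child. [folklore] -/
theorem card_sawWordsTo_n11_x1112_g838 : gPlus 9 2 5 628794940589399504727971937 6 (nextV 628794940589399504711194721 0) [628794940589399504711194721] 0 = 0 := by
  decide +kernel

set_option maxHeartbeats 0 in
/-- Kernel piece (14108 calls). [folklore] -/
theorem card_sawWordsTo_n11_x1112_g839 : sawCodeG 9 2 5 628794940589399504727971936 5 (nextV 628794940589399504727971937 (nextV 628794940589399504711194721 0)) [628794940589399504727971937, 628794940589399504711194721] = 13500 := by
  decide +kernel

/-- Still-born child. [folklore] -/
theorem card_sawWordsTo_n11_x1112_g841 : gPlus 9 2 5 628794940589399504727971937 6 (nextV 628794940589399504711194721 0) [628794940589399504711194721] 1 = 0 := by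
  decide +kernel

/-- Still-born child. [folklore] -/
theorem card_sawWordsTo_n11_x1112_g844 : gPlus 9 2 5 628794940589399504727971937 6 (nextV 628794940589399504711194721 0) [628794940589399504711194721] 2 = 0 := by
  decide +kernel

/-- Still-born child. [folklore] -/
theorem card_sawWordsTo_n11_x1112_g847 : gPlus 9 2 5 628794940589399504727971937 6 (nextV 628794940589399504711194721 0) [628794940589399504711194721] 3 = 0 := by
  decide +kernel

set_option maxHeartbeats 0 in
/-- Kernel piece (27057 calls). [folklore] -/
theorem card_sawWordsTo_n11_x1112_g848 : sawCodeG 9 2 5 628794940589399504727709793 5 (nextV 628794940589399504727971937 (nextV 628794940589399504711194721 0)) [628794940589399504727971937, 628794940589399504711194721] = 27000 := by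
  decide +kernel

/-- Still-born child. [folklore] -/
theorem card_sawWordsTo_n11_x1112_g850 : gPlus 9 2 5 628794940589399504727971937 6 (nextV 628794940589399504711194721 0) [628794940589399504711194721] 4 = 0 := by
  decide +kernel

/-- Kernel piece (1 calls). [folklore] -/
theorem card_sawWordsTo_n11_x1112_g851 : sawCodeG 9 2 5 628794940589399504711194721 5 (nextV 628794940589399504727971937 (nextV 628794940589399504711194721 0)) [628794940589399504727971937, 628794940589399504711194721] = 0 := by
  decide +kernel

set_option maxHeartbeats 0 in
/-- Kernel piece (54466 calls). [folklore] -/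
theorem card_sawWordsTo_n11_x1112_g853 : sawCodeG 9 1 6 628794940589399505801713761 7 (nextV 628794940589399504727971937 (nextV 628794940589399504711194721 0)) [628794940589399504727971937, 628794940589399504711194721] = 61500 := by
  decide +kernel

end Literature.Probability.FitznerVanDerHofstad2017
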